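import Literature.MathematicalPhysics.QuantumFieldTheory.BalabanImbrieJaffe1984to88.BIJ88DeltaLocClose235General
import Literature.MathematicalPhysics.QuantumFieldTheory.BalabanImbrieJaffe1984to88.BIJ88NeumannPropagatorSmallFieldSupDecay

/-!
# `BalabanImbrieJaffe1984to88.BIJ88Decay230SmallFieldCubes` — T. Bałaban, J. Imbrie, A. Jaffe, *Effective action and cluster properties of the
abelian Higgs model*, Commun. Math. Phys. **114** (1988) 257–315 [BalabanImbrieJaffe1988], Sect. 2 p. 263 [PDF 7], **(2.30) FOR `G_{k,loc}(u)` AND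
(2.36) FOR `Δ_{k,loc}(u)` OVER A FAMILY OF TORUS CUBES AT A SMALL NON-FLAT BACKGROUND, HYPOTHESIS-FREE** — the second INSTANTIATION of this
seat's general-background chain `BIJ88DeltaLocClose235General`: p27 g34's `k`-uniform OPERATOR-form [6] (1.10) value member for the cube Neumann
propagators at bondwise-small `U(1)` fields, `BIJ88NeumannPropagatorSmallFieldSupDecay.decay110_smallField_cube_input` (stated by p27 in this
seat's (H1.10) binder shape verbatim), fed into `opDecay230_of_input` and `decay236_of_input` — whence the printed *"|(G_{k,loc}(u)f)(x)| ≦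
ce^{−c dist(suppt f,x)}‖f‖_∞ (2.30)"* and *"|Δ_{k,loc}(u;x₁,x₂)| ≦ ce^{−c|x₁−x₂|} (2.36)"* for gen 15's `gLocT` / `deltaLocT` over any finite family
of no-wrap torus cubes, at every `U(1)` field `u` that is bondwise small inside the cubes, in `d + 1 ≤ 3` dimensions.

statement-level skeleton of published theorems with citation tags; proofs where landed; nothing here is a claim about the Yang–Mills mass gap

PDF held: `paper:balaban1988-cmp114-bij-abelian-higgs-effective-action` (journal page = PDF page + 256); p. 263 [PDF 7] as quoted in this seat's
`BIJ88DeltaLocClose235General` / gen 17's headers; [6] = [Balaban1983RegularityDecay] (CMP **89**) p. 573 (1.10) as transcribed in p27's file.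

CITATION HEADER (lean-in-tree rule).  Part of the lit-balaban TYPED SKELETON (HOME `run/shared/lean/pub/lit-balaban/`), PHASE-2 proof seat p31
gen 20 (unit `lit-balaban-p31-g20`; free-target protocol G.5-34(d), follow-up of TAKING #3: *"instantiate by name the moment they land"* — p27's
provider p347259 has landed).  WHAT IS REPRODUCED: rows **C2.Eq2.30** and **C2.Eq2.36** (`HOME/lit-balaban-r18/ROWS-C2.md`, owner r18; heads
unchanged = p02's abstract hence-steps) as located members AT A BONDWISE-SMALL NON-FLAT BACKGROUND for gen 15's objects with bodies (gen 16/17's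
`opDecay230_flat(_level)` / `decay236_flat(_level)` were the flat members); the [6]-input row **B4.Thm@573** (1.10) (owner r01) enters BY NAME
through p27's member.  Kind «model-level theorems only» (no definition, no `Prop`-valued fact).

THE PRINTED TEXT (verbatim, p. 263 [PDF 7]).  *"The boundary conditions are always at a distance O(r(e_k)) from x₁, x₂, so a straightforward
application of the random walk expansion of [6] shows that |(G_{k,loc}(u)f)(x)| ≦ ce^{−c dist(suppt f,x)}‖f‖_∞, (2.30) … We assume that u is
smooth in the □_α's entering the sum in (2.27)"*; *"|Δ_{k,loc}(u;x₁,x₂)| ≦ ce^{−c|x₁−x₂|}, (2.36)"*.  Here *"u smooth in the □_α's"* is p27/p34's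
bondwise smallness inside each cube: `|u(b) − 1| ≤ T` on the bonds of `□_α*` inside the `L^k`-blocks, `|u(Γ^{(k)}_y) − 1| ≤ δ` for `y ∈ □_α`,
`2(L^k−1)L^k·d·T² + 2δ² ≤ 1/2` (the [I] (4.5.4) regime).

WHAT IS PROVED (theorems only; 0 `sorry`; standard axioms).
* **`opDecay230_smallField`** — (2.30), OPERATOR FORM, for `G_{k,loc}(u) = gLocT (α_kL^{kd}) ε⁻¹ u k cube λ ζ″` over ANY finite family of no-wrap
  torus cubes `□_α = c_α·L^k + Π_i[0, L^kM_{α,i})` (fitting and shorter than the torus), weights `Σ_α|λ_α| ≤ 1`, cut-off `|ζ″| ≤ 1`, at every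
  `U(1)` field `u` bondwise small (`T, δ`) inside every cube: there are `δ₀, c₀ > 0` depending on `(d, ℓ, a)` only such that
  `‖(G_{k,loc}(u)f)(x)‖ ≤ s_k²·#S·c₀e^{−δ₀D/L^k}·F` for every row `x`, every `f` with `‖f‖ ≤ F` supported at sup-torus distance `≥ D` from `x`,
  `S ∋` the cubes active on the row of `x` against `supp f`; every torus with `P.d = d + 1 ≤ 3`, `P.L = ℓ + 1`, every `1 ≤ k ≤ m + K`.
* **`decay236_smallField`** — (2.36) for `Δ_{k,loc}(u) = deltaLocT (α_kL^{kd}) ε⁻¹ u k cube λ ζ″` at the same data: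
  `‖Δ_{k,loc}(u; y₁,y₂)‖ ≤ A·([y₁ = y₂] + #S·a_k·c₀e^{δ₀}·e^{−δ₀|y₁−y₂|_{T^{(k)}}})`, `A = α_kL^{kd}` (gen 15's counting normalization), `S ∋` the
  cubes active on the rows `x ∈ B^k(y₁)`.
HONEST SCOPE.  (i) Exactly the two members whose only [6]-input is (1.10) for the cubes; (2.31)/(2.35)/(2.38)/(2.40)/(2.41)/(4.9) at this
background need (H1.12) (the cube-versus-region closeness at small fields — not in the tree) and (H1.10) for the outer region.  (ii) `d + 1 ≤ 3`
directions, fine level `0`, `1 ≤ k ≤ m + K` (p27's scope); constants `δ₀ = t₀(d, ℓ, a)`, `c₀(d, ℓ, a)` of p27's member, uniform in the torus, in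
`k`, in `u` and in the cube family.  (iii) The multiplicity `#S` and the cube/weight/cut-off DATA are as in gen 16/17 and this seat's general file
(for the printed (2.27) torus data: p29's `card_activeLabels_le`).  (iv) No Hölder / derivative members.
Imports: this seat's `BIJ88DeltaLocClose235General` (v1.1), p27's `BIJ88NeumannPropagatorSmallFieldSupDecay` (p347259).  Literature + Mathlib
only.  Unit `lit-balaban-p31` (literature-prover-lit-balaban-p31-g20-0), 2026-08-23.  NOT summit progress.
-/

open scoped BigOperators Matrix ComplexConjugate
open Finset Matrix

namespace Literature.MathematicalPhysics.QuantumFieldTheory.BalabanImbrieJaffe1984to88.BIJ88Decay230SmallFieldCubes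

open Literature.MathematicalPhysics.QuantumFieldTheory.Balaban1983to89
open BIJ88Sect3Statements (U1 toC starB)
open BIJ85BlockAveragesTorus BIJ85BlockAveragesTorusK
open BIJ88NeumannPropagator227Torus (gBox)
open BIJ88DeltaLoc234Torus (gLocT deltaLocT)
open BIJ88NeumannPropagatorFlatDecayCube (cubeT)
open BIJ88NeumannPropagatorSmallFieldSupDecay (decay110_smallField_cube_input)
open BIJ88DeltaLocClose235General (opDecay230_of_input decay236_of_input)

noncomputable section

/-- **(2.30), OPERATOR FORM, FOR `G_{k,loc}(u)` OVER A FAMILY OF TORUS CUBES AT A SMALL NON-FLAT `u`, hypothesis-free** (p. 263 (2.30)):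
p27's `decay110_smallField_cube_input` ([6] (1.10), `k`-uniform `‖f‖_∞` form, cubes, bondwise-small fields) in this seat's `opDecay230_of_input`.
[cite: BalabanImbrieJaffe1988, (2.30) p.263] -/
theorem opDecay230_smallField (d ℓ : ℕ) (hd3 : d + 1 ≤ 3) (hℓ : 1 ≤ ℓ) {a : ℝ} (ha : 0 < a) :
    ∃ δ₀ c₀ : ℝ, 0 < δ₀ ∧ 0 < c₀ ∧ ∀ (P : Params) (hPd : P.d = d + 1), P.L = ℓ + 1 →
      ∀ k : ℕ, 1 ≤ k → k ≤ P.m + P.K → ∀ (ι : Type) [Fintype ι] (cube : ι → Finset (Balaban1983to89.Site P 0))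
        (lam : ι → Balaban1983to89.Site P 0 → Balaban1983to89.Site P 0 → ℝ)
        (ζ'' : Balaban1983to89.Site P 0 → Balaban1983to89.Site P 0 → ℝ),
        (∀ α, ∃ c M : Fin (d + 1) → ℕ, (∀ i, 1 ≤ M i) ∧ (∀ i, c i * P.L ^ k + P.L ^ k * M i ≤ P.sitesPerDir 0) ∧
            (∀ i, P.L ^ k * M i < P.sitesPerDir 0) ∧ cube α = cubeT hPd (P.L ^ k) c fun i => P.L ^ k * M i) →
        (∀ x y, ∑ α, |lam α x y| ≤ 1) → (∀ x y, |ζ'' x y| ≤ 1) →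
      ∀ (U : GaugeField P 0 U1) (T δ : ℝ),
        (∀ α, ∀ b ∈ starB (cube α), blkIter k b.src = blkIter k b.tgt → ‖toC (U b) - 1‖ ≤ T) →
        (∀ α, ∀ y ∈ cube α, ‖holCK U k y - 1‖ ≤ δ) →
        2 * (((P.L : ℝ) ^ k - 1) * (P.L : ℝ) ^ k) * P.d * T ^ 2 + 2 * δ ^ 2 ≤ 1 / 2 →
      ∀ (x : Balaban1983to89.Site P 0) (f : Balaban1983to89.Site P 0 → ℂ) (F D : ℝ),
        (∀ y, ‖f y‖ ≤ F) → (∀ y, f y ≠ 0 → D ≤ B5Ineq137Torus.T P 0 x y) →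
      ∀ S : Finset ι, (∀ α y, ζ'' x y * lam α x y ≠ 0 → f y ≠ 0 → α ∈ S) →
        ‖(gLocT (B1RG242Torus.α P a k * (P.L : ℝ) ^ (k * P.d)) P.eps⁻¹ U k cube lam ζ'' *ᵥ f) x‖ ≤
          P.spacing k ^ 2 * (S.card * (c₀ * Real.exp (-(δ₀ * (((P.L : ℝ) ^ k)⁻¹ * D))) * F)) := by
  obtain ⟨δ₀, c₀, hδ₀, hc₀, H⟩ := decay110_smallField_cube_input d ℓ hd3 hℓ ha
  refine ⟨δ₀, c₀, hδ₀, hc₀, ?_⟩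
  intro P hPd hPL k hk1 hk ι _ cube lam ζ hcube hlam hζ U T δ hInt hTree hsmall x f F D hF hsupp S hS
  refine opDecay230_of_input _ _ U cube hlam hζ (fun α x' g G E hG hsuppg => ?_) x f F D hF hsupp S hS
  obtain ⟨c, M, hM, hfit, hN, hc⟩ := hcube α
  have hI := hInt α
  have hT := hTree α
  rw [hc] at hI hT ⊢
  exact H P hPd hPL k hk1 hk c M hM hfit hN U T δ hI hT hsmall x' g G E hG hsuppg

/-- **(2.36) FOR `Δ_{k,loc}(u)` OVER A FAMILY OF TORUS CUBES AT A SMALL NON-FLAT `u`, hypothesis-free** (p. 263 (2.36)): p27's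
`decay110_smallField_cube_input` in this seat's `decay236_of_input` (the `Q_k(u)G_{k,loc}(u)Q_k(u)ᴴ` sandwich at the block lower bound of the
metric, prefactor `A²s_k²L^{−kd} = A·a_k`). [cite: BalabanImbrieJaffe1988, (2.36) p.263] -/
theorem decay236_smallField (d ℓ : ℕ) (hd3 : d + 1 ≤ 3) (hℓ : 1 ≤ ℓ) {a : ℝ} (ha : 0 < a) :
    ∃ δ₀ c₀ : ℝ, 0 < δ₀ ∧ 0 < c₀ ∧ ∀ (P : Params) (hPd : P.d = d + 1), P.L = ℓ + 1 →
      ∀ k : ℕ, 1 ≤ k → k ≤ P.m + P.K → ∀ (ι : Type) [Fintype ι] (cube : ι → Finset (Balaban1983to89.Site P 0))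
        (lam : ι → Balaban1983to89.Site P 0 → Balaban1983to89.Site P 0 → ℝ)
        (ζ'' : Balaban1983to89.Site P 0 → Balaban1983to89.Site P 0 → ℝ),
        (∀ α, ∃ c M : Fin (d + 1) → ℕ, (∀ i, 1 ≤ M i) ∧ (∀ i, c i * P.L ^ k + P.L ^ k * M i ≤ P.sitesPerDir 0) ∧
            (∀ i, P.L ^ k * M i < P.sitesPerDir 0) ∧ cube α = cubeT hPd (P.L ^ k) c fun i => P.L ^ k * M i) →
        (∀ x y, ∑ α, |lam α x y| ≤ 1) → (∀ x y, |ζ'' x y| ≤ 1) →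
      ∀ (U : GaugeField P 0 U1) (T δ : ℝ),
        (∀ α, ∀ b ∈ starB (cube α), blkIter k b.src = blkIter k b.tgt → ‖toC (U b) - 1‖ ≤ T) →
        (∀ α, ∀ y ∈ cube α, ‖holCK U k y - 1‖ ≤ δ) →
        2 * (((P.L : ℝ) ^ k - 1) * (P.L : ℝ) ^ k) * P.d * T ^ 2 + 2 * δ ^ 2 ≤ 1 / 2 →
      ∀ (y₁ y₂ : Balaban1983to89.Site P (0 + k)) (S : Finset ι),
        (∀ x ∈ blockK k y₁, ∀ α y, ζ'' x y * lam α x y ≠ 0 → α ∈ S) →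
        ‖deltaLocT (B1RG242Torus.α P a k * (P.L : ℝ) ^ (k * P.d)) P.eps⁻¹ U k cube lam ζ'' y₁ y₂‖ ≤
          (B1RG242Torus.α P a k * (P.L : ℝ) ^ (k * P.d)) *
            ((if y₁ = y₂ then 1 else 0) +
              S.card * B1.aSeq a P.L k * (c₀ * Real.exp δ₀) * Real.exp (-(δ₀ * (B5Ineq137Torus.T P (0 + k) y₁ y₂)))) := by
  obtain ⟨δ₀, c₀, hδ₀, hc₀, H⟩ := decay110_smallField_cube_input d ℓ hd3 hℓ ha
  refine ⟨δ₀, c₀, hδ₀, hc₀, ?_⟩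
  intro P hPd hPL k hk1 hk ι _ cube lam ζ hcube hlam hζ U T δ hInt hTree hsmall y₁ y₂ S hS
  have hk0 : 0 + k ≤ P.m + P.K := by omega
  refine decay236_of_input hk1 hk0 ha P.eps⁻¹ U cube hlam hζ hδ₀.le hc₀.le (fun α x' g G E hG hsuppg => ?_) y₁ y₂ S hS
  obtain ⟨c, M, hM, hfit, hN, hc⟩ := hcube α
  have hI := hInt α
  have hT := hTree α
  rw [hc] at hI hT ⊢
  exact H P hPd hPL k hk1 hk c M hM hfit hN U T δ hI hT hsmall x' g G E hG hsuppg

end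

end Literature.MathematicalPhysics.QuantumFieldTheory.BalabanImbrieJaffe1984to88.BIJ88Decay230SmallFieldCubes
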